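import Mathlib
import Literature.Computability.AlgebraicComplexity.ArithCircuitProofs
import Literature.Computability.AlgebraicComplexity.IMMInVPProofs
import Summits.ValiantsHypothesis.ValiantsHypothesis.Theorems.DivisionGapTriangularDimersDivisionEasyOddJoinDefs
import Summits.ValiantsHypothesis.ValiantsHypothesis.Theorems.DivisionGapTriangularDimersDivisionEasyStubShufflingDivisionAux1
import Summits.ValiantsHypothesis.ValiantsHypothesis.Theorems.DivisionGapTriangularDimersDivisionEasyStubFaceLow

/-!
# Crux `DivisionGap.TriangularDimersDivisionEasy` (stmt-ValiantsHypothesis-5067), line `Sketch` —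
registered stub `stub_evenTransfer`

THE EVEN TRANSFER: quasi-polynomial division complexity (`DivEasy`, the Hrubeš–Yehudayoff normal
form `F · h = g`, `h ≠ 0`, with both `F · h` and `h` of monotone fan-in-two size
`≤ 2 ^ ((log₂ n + c) ^ c)`) passes from the even-subgraph polynomial in split variables
`evenSplit` to the odd-join polynomial `oddJoin` of the triangular rhombus `R_n`, GIVEN

* `hB` — absorption of polynomial overheads `k · n ^ d + k` into the threshold `bound`;
* `hS` — for even `n`, the free variable swap `swapVar n` along the reference perfect matching
  carries `evenSplit n` to `oddJoinSplit n`;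
* `hφ` — the monotone chart map `substY n` carries `oddJoinSplit n` to `oddJoin n`, each of its
  values costing at most `2` gates.

## Proof

Let `⟨c, hc⟩ : DivEasy evenSplit` and take `c'` from `hB c 4 4`.  Fix `n`.

* `n` odd: there is no odd cover (HANDSHAKE: for `J ⊆ edges n` the degrees sum to `2 |J|`, an
  even number, while `n²` odd numbers have an odd sum), so `oddJoin n = 0`; the witness `h = 1`
  has `L(0 · 1) + L(1) = 0`.
* `n` even: from `⟨h, h ≠ 0, L(evenSplit n · h) + L(h) ≤ bound c n⟩` put
  `h'' = substY_* (swapVar_* h)`.  Renaming along a permutation is free and injective, the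
  substitution costs `≤ Σ_e L(substY n e) ≤ 2 n⁴` extra gates (`L(f(g)) ≤ L(f) + Σ L(gᵢ)`), and
  both maps are multiplicative, so `oddJoin n · h'' = substY_* (swapVar_* (evenSplit n · h))` and
  `L(oddJoin n · h'') + L(h'') ≤ bound c n + 4 n⁴ ≤ bound c' n`; finally `h'' ≠ 0` by positivity
  over `ℝ≥0` (a non-zero `ℝ≥0`-polynomial stays non-zero under substitution of non-zero
  `ℝ≥0`-polynomials, and every `substY n e` is `≠ 0` at the all-ones point).
-/

-- `Summit.ValiantsHypothesis.ValiantsHypothesis.…` is the tree's mandated single-conjunct layout (Sub = Summit).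
set_option linter.dupNamespace false

namespace Summit.ValiantsHypothesis.ValiantsHypothesis.Theorems.TriangularDimersDivisionEasy.OddJoin

open scoped BigOperators NNReal
open Finset MvPolynomial Literature.Computability.AlgebraicComplexity

noncomputable section

namespace EvenTransfer
/-! ### Helper lemmas for `stub_evenTransfer` (this file's private namespace) -/

/-! #### Odd `n`: no odd covers -/

/-- For odd `n` the rhombus `R_n` has no spanning edge set with all degrees odd (handshake
lemma: the degrees sum to twice the number of edges, but `n²` odd numbers have an odd sum).
[folklore] -/
theorem oddCovers_eq_empty {n : ℕ} (hn : Odd n) : oddCovers n = ∅ := by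
  refine eq_empty_of_forall_notMem fun J hJ => ?_
  unfold oddCovers at hJ
  obtain ⟨hsub, hodd⟩ := mem_filter.mp hJ
  rw [mem_powerset] at hsub
  have hsum := FaceLow.sum_deg_eq J fun e he => FaceLow.fst_ne_snd_of_mem_edges (hsub he)
  have h1 : Odd (∑ v, deg J v) := by
    rw [Finset.odd_sum_iff_odd_card_odd]
    rw [filter_true_of_mem fun v _ => hodd v, card_univ, Fintype.card_prod, Fintype.card_fin]
    exact hn.mul hn
  rw [hsum] at h1
  exact Nat.not_odd_iff_even.mpr (even_two_mul _) h1

/-- For odd `n` the odd-join polynomial vanishes. [folklore] -/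
theorem oddJoin_eq_zero {n : ℕ} (hn : Odd n) : oddJoin n = 0 := by
  unfold oddJoin
  rw [oddCovers_eq_empty hn, sum_empty]

/-! #### Even `n`: the chart map is non-vanishing and cheap -/

/-- Every value of the chart map `substY n` is a non-zero polynomial (it is `≠ 0` at the
all-ones point). [folklore] -/
theorem substY_ne_zero (n : ℕ) (e : Var n) : substY n e ≠ 0 := by
  intro h
  have h1 : eval (fun _ => (1 : ℝ≥0)) (substY n e) ≠ 0 := by
    unfold substY yv
    split_ifs <;> simp
  exact h1 (by rw [h, map_zero])

/-- The crux's ring has `n ^ 4` variables. [folklore] -/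
theorem card_var (n : ℕ) : Fintype.card (Var n) = n ^ 4 := by
  simp only [Fintype.card_prod, Fintype.card_fin]
  ring

/-- The total cost of the chart map is at most `2 n⁴` gates. [folklore] -/
theorem sum_complexity_substY_le {n : ℕ} (h2 : ∀ e : Var n, complexity (substY n e) ≤ 2) :
    ∑ e : Var n, complexity (substY n e) ≤ 2 * n ^ 4 :=
  calc ∑ e : Var n, complexity (substY n e) ≤ ∑ _e : Var n, 2 := sum_le_sum fun e _ => h2 e
    _ = 2 * n ^ 4 := by rw [sum_const, card_univ, card_var, smul_eq_mul, mul_comm]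

/-- Substituting the chart map costs at most `2 n⁴` extra gates (`L(f(g)) ≤ L(f) + Σ L(gᵢ)`).
[folklore] -/
theorem complexity_aeval_substY_le {n : ℕ} (h2 : ∀ e : Var n, complexity (substY n e) ≤ 2)
    (q : MvPolynomial (Var n) ℝ≥0) :
    complexity (aeval (substY n) q) ≤ complexity q + 2 * n ^ 4 :=
  (complexity_aeval_le q _).trans (Nat.add_le_add_left (sum_complexity_substY_le h2) _)

end EvenTransfer

open EvenTransfer in
/-- Registered stub `stub_evenTransfer`: given the absorption of polynomial overheads (`hB`),
the swap identity for even `n` (`hS`) and the cheap monotone chart identity (`hφ`),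
quasi-polynomial division complexity of the even-subgraph polynomial `evenSplit` implies that
of the odd-join polynomial `oddJoin`. [folklore] -/
theorem stub_evenTransfer
    (hB : ∀ c k d : ℕ, ∃ c' : ℕ, ∀ n : ℕ, bound c n + k * n ^ d + k ≤ bound c' n)
    (hS : ∀ n : ℕ, Even n → rename (swapVar n) (evenSplit n) = oddJoinSplit n)
    (hφ : ∀ n : ℕ, aeval (substY n) (oddJoinSplit n) = oddJoin n ∧
      ∀ e : Var n, complexity (substY n e) ≤ 2) :
    DivEasy evenSplit → DivEasy oddJoin := by
  rintro ⟨c, hc⟩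
  obtain ⟨c', hc'⟩ := hB c 4 4
  refine ⟨c', fun n => ?_⟩
  rcases Nat.even_or_odd n with hn | hn
  · -- even `n`: transport the witness along the swap and the chart map
    obtain ⟨h, h0, hle⟩ := hc n
    have hh' : rename (swapVar n) h ≠ 0 := fun h1 =>
      h0 (rename_injective _ (swapVar n).injective (by rw [h1, map_zero]))
    refine ⟨aeval (substY n) (rename (swapVar n) h),
      Shuffling.Division.aeval_ne_zero _ _ hh' (substY_ne_zero n), ?_⟩
    have hid : oddJoin n * aeval (substY n) (rename (swapVar n) h) =
        aeval (substY n) (rename (swapVar n) (evenSplit n * h)) := by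
      rw [map_mul, hS n hn, map_mul, (hφ n).1]
    rw [hid]
    calc complexity (aeval (substY n) (rename (swapVar n) (evenSplit n * h))) +
          complexity (aeval (substY n) (rename (swapVar n) h))
        ≤ (complexity (rename (swapVar n) (evenSplit n * h)) + 2 * n ^ 4) +
          (complexity (rename (swapVar n) h) + 2 * n ^ 4) :=
          add_le_add (complexity_aeval_substY_le (hφ n).2 _)
            (complexity_aeval_substY_le (hφ n).2 _)
      _ = complexity (evenSplit n * h) + complexity h + 4 * n ^ 4 := by
          rw [complexity_rename_of_injective_holds (swapVar n).injective,
            complexity_rename_of_injective_holds (swapVar n).injective]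
          ring
      _ ≤ bound c n + 4 * n ^ 4 + 4 := by omega
      _ ≤ bound c' n := hc' n
  · -- odd `n`: `oddJoin n = 0`, witness `h = 1`
    refine ⟨1, one_ne_zero, ?_⟩
    rw [oddJoin_eq_zero hn, zero_mul, ← C_0, ← C_1, complexity_C_holds, complexity_C_holds]
    exact Nat.zero_le _

end

end Summit.ValiantsHypothesis.ValiantsHypothesis.Theorems.TriangularDimersDivisionEasy.OddJoin
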